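import Literature.NumberTheory.Transcendental.CurvePeriodsStokesProofs
import Literature.NumberTheory.Transcendental.AnalytificationImplicit
import Mathlib.Analysis.Analytic.IsolatedZeros
import Mathlib.Analysis.Analytic.Polynomial
import Mathlib.LinearAlgebra.Matrix.Rank
import Mathlib.LinearAlgebra.Matrix.NonsingularInverse
import HarnessLib

/-!
# Periods of curve type: local holomorphic charts of an embedded smooth affine curve

Companion of `Literature/NumberTheory/Transcendental/CurvePeriods.lean` (Huber–Wüstholz 2022,
Thm. 13.3 (2), rendered on explicit period symbols `(Z, ω, γ)`; the general statement is the named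
fact `HuberWustholzCurvePeriods`). The curves of the rendering are EMBEDDED smooth affine curves
over `ℚ̄`: `Z = {F₁ = ⋯ = Fₘ = 0} ⊂ ℂⁿ` with the Jacobian condition `rank (∂Fⱼ/∂xᵢ(z)) = n − 1` and
no isolated points (`CurveData.IsSmoothAffineCurve`; book §3.3.1 and Def. 12.6: smooth affine
curves, whose complex points form a Riemann surface `Z^an`). This file proves the basic local
structure theorem behind the words "`Z^an` is a complex manifold of dimension one" in this
embedded setting, for use in every genus (local parametrisations of `Z(ℂ)`, tangent lines,
smoothing and lifting of paths):

* `CurveData.IsSmoothAffineCurve.exists_localChart` — **near every point `z₀ ∈ Z(ℂ)` the curve is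
  the graph of a holomorphic map over one of the coordinates**: there are a coordinate `i₀`, a
  radius `ε > 0`, an open neighbourhood `Ω` of `z₀` and a holomorphic `ψ : B(z₀,ᵢ₀, ε) → ℂⁿ` with
  `Z(ℂ) ∩ Ω = ψ(B)`, `ψ(w)ᵢ₀ = w`, `ψ(zᵢ₀) = z` for `z ∈ Z(ℂ) ∩ Ω`.
  Proof: the rank condition gives `n − 1` equations and `n − 1` coordinates with invertible
  Jacobian minor at `z₀` (`exists_jacobianMinor`, row rank = column rank); the holomorphic
  implicit function theorem of the tree (`exists_implicitChart`,
  `AnalytificationImplicit.lean`) makes the common zero set `W` of THESE equations a graph near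
  `z₀`; and `Z ∩ Ω = W ∩ Ω` after shrinking, because the remaining equations restrict to
  holomorphic functions of one variable on `W` vanishing on `Z`, which accumulates at `z₀`
  (no isolated points), hence vanishing identically near `z₀` (principle of isolated zeros,
  `AnalyticAt.frequently_zero_iff_eventually_zero`).
* `deriv_mem_tangentSpace_of_eventually_mem`, `exists_localChart_deriv` — the velocity `ψ′(w)`
  of the chart is a tangent vector with `ψ′(w)ᵢ₀ = 1`, and every tangent vector at `ψ(w)` is
  `vᵢ₀ · ψ′(w)` (the tangent space is the complex line `ℂ · ψ′(w)`, `tangent_parallel`).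

## References

* A. Huber, G. Wüstholz, *Transcendence and Linear Relations of 1-Periods*, Cambridge Tracts in
  Mathematics 227, CUP 2022 [HuberWustholz2022]: §3.3.1 (p. 44 of the held text), Def. 12.6
  (p. 116), Thm. 13.3 (2) (p. 121).
* J.-P. Serre, *Géométrie algébrique et géométrie analytique*, Ann. Inst. Fourier 6 (1956), §2
  n°6 Cor. 2 (simple points are manifold points of the analytification).
* R. C. Gunning, H. Rossi, *Analytic functions of several complex variables*, Prentice-Hall 1965,
  Ch. I §B Thm. 9 (holomorphic implicit function theorem).
-/

noncomputable section

open scoped BigOperators Topology Matrix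
open MvPolynomial Set Filter

namespace Literature.NumberTheory.Transcendental

namespace CurvePeriods

/-! ### Linear algebra: an invertible maximal minor -/

/-- If the `c` rows of a `c × n` matrix over `ℂ` are linearly independent, then for some injective
choice `a` of `c` columns the square submatrix on these columns has non-zero determinant (row
rank = column rank). [folklore] -/
theorem exists_cols_det_ne_zero {c n : ℕ} (M : Matrix (Fin c) (Fin n) ℂ)
    (hM : LinearIndependent ℂ M.row) :
    ∃ a : Fin c → Fin n, Function.Injective a ∧ (M.submatrix id a).det ≠ 0 := by
  classical
  have hrank : M.rank = c := by
    rw [Matrix.rank_eq_finrank_span_row, finrank_span_eq_card hM, Fintype.card_fin]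
  have hcols : Submodule.span ℂ (Set.range M.col) = ⊤ := by
    apply Submodule.eq_top_of_finrank_eq
    rw [← Matrix.rank_eq_finrank_span_cols, hrank, Module.finrank_fintype_fun_eq_card,
      Fintype.card_fin]
  obtain ⟨κ, a, ha, hspan, hli⟩ := exists_linearIndependent' ℂ M.col
  haveI : Finite κ := Finite.of_injective a ha
  letI : Fintype κ := Fintype.ofFinite κ
  have hcard : Fintype.card κ = c := by
    have h := finrank_span_eq_card hli
    rw [hspan, hcols, finrank_top, Module.finrank_fintype_fun_eq_card, Fintype.card_fin] at h
    exact h.symm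
  obtain ⟨e⟩ : Nonempty (Fin c ≃ κ) := ⟨(Fintype.equivFinOfCardEq hcard).symm⟩
  refine ⟨a ∘ e, ha.comp e.injective, ?_⟩
  have hli' : LinearIndependent ℂ (M.submatrix id (a ∘ e)).col := by
    have : (M.submatrix id (a ∘ e)).col = (M.col ∘ a) ∘ e := by
      funext j
      rfl
    rw [this]
    exact hli.comp e e.injective
  have hunit : IsUnit (M.submatrix id (a ∘ e)) :=
    Matrix.linearIndependent_cols_iff_isUnit.mp hli'
  exact ((Matrix.isUnit_iff_isUnit_det _).mp hunit).ne_zero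

variable {Z : CurveData}

/-- **An invertible Jacobian minor at a point of a smooth affine curve.** If `n = d + 1`, there are
`d` equations `F_{j(l)}` and `d` distinct coordinates `x_{a(k)}`, all different from a coordinate
`x_{i₀}`, with `det (∂F_{j(l)}/∂x_{a(k)}(z₀)) ≠ 0` (from `rank = n − 1`). [folklore] -/
theorem exists_jacobianMinor (hZ : Z.IsSmoothAffineCurve) {z₀ : Fin Z.n → ℂ} (hz₀ : z₀ ∈ Z.points)
    {d : ℕ} (hn : Z.n = d + 1) :
    ∃ (j : Fin d → Fin Z.m) (a : Fin d → Fin Z.n) (i₀ : Fin Z.n), Function.Injective a ∧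
      (∀ k, a k ≠ i₀) ∧ (Matrix.of fun k l : Fin d => Z.gradient (j l) z₀ (a k)).det ≠ 0 := by
  classical
  -- `d` independent gradients
  obtain ⟨κ, b, _, hspan, hli⟩ := exists_linearIndependent' ℂ (fun j => Z.gradient j z₀)
  haveI : Finite κ := hli.finite
  letI : Fintype κ := Fintype.ofFinite κ
  have hcard : Fintype.card κ = d := by
    rw [linearIndependent_iff_card_eq_finrank_span.mp hli, Set.finrank, hspan, hZ.rank_eq z₀ hz₀]
    omega
  obtain ⟨e⟩ : Nonempty (Fin d ≃ κ) := ⟨(Fintype.equivFinOfCardEq hcard).symm⟩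
  let j : Fin d → Fin Z.m := b ∘ e
  let M : Matrix (Fin d) (Fin Z.n) ℂ := fun k i => Z.gradient (j k) z₀ i
  have hM : LinearIndependent ℂ M.row := hli.comp e e.injective
  obtain ⟨a, ha, hdet⟩ := exists_cols_det_ne_zero M hM
  -- a coordinate not among the `a k`
  have hnsurj : ¬ Function.Surjective a := fun hs => by
    have h := Fintype.card_le_of_surjective a hs
    simp only [Fintype.card_fin, hn] at h
    omega
  obtain ⟨i₀, hi₀'⟩ := not_forall.mp hnsurj
  have hi₀ : ∀ k, a k ≠ i₀ := fun k hk => hi₀' ⟨k, hk⟩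
  refine ⟨j, a, i₀, ha, hi₀, ?_⟩
  have ht : (Matrix.of fun k l : Fin d => Z.gradient (j l) z₀ (a k)) = (M.submatrix id a)ᵀ := by
    ext k l
    rfl
  rwa [ht, Matrix.det_transpose]

/-- The ambient dimension of a smooth affine curve with a point is positive (a point of `ℂ⁰` is
isolated). [folklore] -/
theorem n_ne_zero_of_mem (hZ : Z.IsSmoothAffineCurve) {z₀ : Fin Z.n → ℂ} (hz₀ : z₀ ∈ Z.points) :
    Z.n ≠ 0 := by
  intro h0
  have hsub : Subsingleton (Fin Z.n → ℂ) := by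
    rw [h0]
    infer_instance
  have hempty : Z.points \ {z₀} = ∅ :=
    Set.eq_empty_of_forall_notMem fun z hz => hz.2 (Subsingleton.elim z z₀)
  have h := hZ.not_isolated z₀ hz₀
  rw [hempty, closure_empty] at h
  exact h

/-! ### Tangent vectors from curves on `Z` -/

/-- **The velocity of a holomorphic curve on `Z` is a tangent vector**: if `ψ : ℂ → ℂⁿ` is
differentiable at `w` and `ψ(v) ∈ Z(ℂ)` for `v` near `w`, then `ψ′(w) ∈ T_{ψ(w)} Z` (differentiate
`Fⱼ ∘ ψ ≡ 0`). [folklore] -/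
theorem deriv_mem_tangentSpace_of_eventually_mem {ψ : ℂ → (Fin Z.n → ℂ)} {w : ℂ}
    (hψ : DifferentiableAt ℂ ψ w) (hmem : ∀ᶠ v in 𝓝 w, ψ v ∈ Z.points) :
    deriv ψ w ∈ Z.tangentSpace (ψ w) := by
  intro j
  have h1 : HasDerivAt (fun v => eval (ψ v) (Z.F j))
      ((∑ i, eval (ψ w) (pderiv i (Z.F j)) •
        (ContinuousLinearMap.proj i : (Fin Z.n → ℂ) →L[ℂ] ℂ)) (deriv ψ w)) w :=
    (hasFDerivAt_eval (Z.F j) (ψ w)).comp_hasDerivAt w hψ.hasDerivAt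
  have h2 : HasDerivAt (fun v => eval (ψ v) (Z.F j)) 0 w :=
    (hasDerivAt_const w (0 : ℂ)).congr_of_eventuallyEq (hmem.mono fun v hv => hv j)
  have h := h1.unique h2
  show ∑ i, eval (ψ w) (pderiv i (Z.F j)) * deriv ψ w i = 0
  simpa only [FunLike.coe_sum, Finset.sum_apply, FunLike.coe_smul,
    Pi.smul_apply, ContinuousLinearMap.proj_apply, smul_eq_mul] using h

/-- If `ψ(v)ᵢ₀ = v` near `w`, then `ψ′(w)ᵢ₀ = 1`. [folklore] -/
theorem deriv_apply_eq_one_of_eventually_eq {n : ℕ} {ψ : ℂ → (Fin n → ℂ)} {w : ℂ} {i₀ : Fin n}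
    (hψ : DifferentiableAt ℂ ψ w) (h : ∀ᶠ v in 𝓝 w, ψ v i₀ = v) : deriv ψ w i₀ = 1 := by
  have h1 : HasDerivAt (fun v => ψ v i₀) (deriv ψ w i₀) w := (hasDerivAt_pi.mp hψ.hasDerivAt) i₀
  have h2 : HasDerivAt (fun v => ψ v i₀) 1 w := (hasDerivAt_id w).congr_of_eventuallyEq h
  exact h1.unique h2

/-- On a smooth affine curve a tangent vector `u` with `uᵢ₀ = 1` spans the tangent line:
`v = vᵢ₀ · u` for every tangent vector `v` at the same point. [folklore] -/
theorem eq_smul_of_mem_tangentSpace (hZ : Z.IsSmoothAffineCurve) {z : Fin Z.n → ℂ}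
    (hz : z ∈ Z.points) {u v : Fin Z.n → ℂ} (hu : u ∈ Z.tangentSpace z) (hv : v ∈ Z.tangentSpace z)
    {i₀ : Fin Z.n} (hu1 : u i₀ = 1) : v = v i₀ • u := by
  funext j
  have h := tangent_parallel hZ hz hv hu i₀ j
  rw [hu1, mul_one] at h
  rw [h, Pi.smul_apply, smul_eq_mul, mul_comm]

/-! ### The local chart -/

/-- The splitting of the coordinates of `ℂ^{d+1}` into a distinguished one `i₀` and `d` others
`a(k)` (injective, avoiding `i₀`), as an equivalence `Fin 1 ⊕ Fin d ≃ Fin n`. [folklore] -/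
theorem exists_coordEquiv {n d : ℕ} (hn : n = d + 1) (a : Fin d → Fin n) (i₀ : Fin n)
    (ha : Function.Injective a) (hi₀ : ∀ k, a k ≠ i₀) :
    ∃ E : Fin 1 ⊕ Fin d ≃ Fin n, (∀ t, E (Sum.inl t) = i₀) ∧ ∀ k, E (Sum.inr k) = a k := by
  let f : Fin 1 ⊕ Fin d → Fin n := Sum.elim (fun _ => i₀) a
  have hf : Function.Bijective f := by
    rw [Fintype.bijective_iff_injective_and_card]
    refine ⟨Function.Injective.sumElim (fun x y _ => Subsingleton.elim x y) ha
      (fun _ k h => hi₀ k h.symm), ?_⟩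
    simp only [Fintype.card_sum, Fintype.card_fin, hn]
    omega
  exact ⟨Equiv.ofBijective f hf, fun _ => rfl, fun _ => rfl⟩

/-- **Local holomorphic chart over a prescribed coordinate.** If at `z₀ ∈ Z(ℂ)` the Jacobian
minor `det (∂F_{j(l)}/∂x_{a(k)}(z₀))` of `d = n − 1` equations and the `d` coordinates other than
`i₀` is invertible, then near `z₀` the curve is the graph of a holomorphic map over the
coordinate `x_{i₀}`: there are `ε > 0`, an open neighbourhood `Ω` of `z₀` and `ψ : ℂ → ℂⁿ`
holomorphic on `B = B(z₀,ᵢ₀, ε)` with `ψ(w) ∈ Z(ℂ) ∩ Ω`, `ψ(w)ᵢ₀ = w` for `w ∈ B` and `zᵢ₀ ∈ B`,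
`ψ(zᵢ₀) = z` for `z ∈ Z(ℂ) ∩ Ω` (holomorphic implicit function theorem for the `d` selected
equations, `exists_implicitChart`; the remaining equations vanish identically on the graph near
`z₀` by the principle of isolated zeros, `z₀` being a non-isolated point of `Z(ℂ)`).
[cite: HuberWustholz2022, §3.3.1 (p. 44), Def. 12.6 (p. 116)] -/
theorem exists_localChart_of_minor (hZ : Z.IsSmoothAffineCurve) {z₀ : Fin Z.n → ℂ}
    (hz₀ : z₀ ∈ Z.points) {d : ℕ} (hn : Z.n = d + 1) (j : Fin d → Fin Z.m) (a : Fin d → Fin Z.n)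
    (i₀ : Fin Z.n) (ha : Function.Injective a) (hi₀ : ∀ k, a k ≠ i₀)
    (hdet : (Matrix.of fun k l : Fin d => Z.gradient (j l) z₀ (a k)).det ≠ 0) :
    ∃ (ε : ℝ) (Ω : Set (Fin Z.n → ℂ)) (ψ : ℂ → (Fin Z.n → ℂ)), 0 < ε ∧ IsOpen Ω ∧
      z₀ ∈ Ω ∧ AnalyticOnNhd ℂ ψ (Metric.ball (z₀ i₀) ε) ∧
      (∀ z ∈ Ω, z ∈ Z.points → z i₀ ∈ Metric.ball (z₀ i₀) ε ∧ ψ (z i₀) = z) ∧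
      (∀ w ∈ Metric.ball (z₀ i₀) ε, ψ w ∈ Ω ∧ ψ w ∈ Z.points ∧ ψ w i₀ = w) := by
  classical
  obtain ⟨E, hEl, hEr⟩ := exists_coordEquiv hn a i₀ ha hi₀
  -- the implicit function chart for the selected equations
  have hJ : (Matrix.of fun i l : Fin d => eval z₀ (pderiv (E (Sum.inr i)) (Z.F (j l)))).det ≠ 0 := by
    have : (Matrix.of fun i l : Fin d => eval z₀ (pderiv (E (Sum.inr i)) (Z.F (j l)))) =
        Matrix.of fun k l : Fin d => Z.gradient (j l) z₀ (a k) := by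
      ext k l
      rw [Matrix.of_apply, Matrix.of_apply, hEr]
      rfl
    rwa [this]
  obtain ⟨Ω, T, ψ, hΩo, hz₀Ω, hTo, hψT, hP1, hP2⟩ :=
    exists_implicitChart E (fun l => Z.F (j l)) z₀ hJ
  -- pass to one complex variable
  let cL : ℂ →L[ℂ] (Fin 1 → ℂ) := ContinuousLinearMap.pi fun _ => ContinuousLinearMap.id ℂ ℂ
  have hcL : ∀ w : ℂ, cL w = fun _ => w := fun _ => rfl
  have hfree : ∀ z : Fin Z.n → ℂ, (fun t => z (E (Sum.inl t))) = cL (z i₀) := fun z => by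
    funext t
    rw [hcL, hEl]
  let ψ' : ℂ → (Fin Z.n → ℂ) := fun w => ψ (cL w)
  let T' : Set ℂ := cL ⁻¹' T
  have hT'o : IsOpen T' := hTo.preimage cL.continuous
  have hψ'T' : AnalyticOnNhd ℂ ψ' T' := fun w hw => (hψT (cL w) hw).comp (cL.analyticAt w)
  -- the chart property for the selected equations, in the variable `w = z i₀`
  have hQ1 : ∀ z ∈ Ω, z ∈ Z.points → z i₀ ∈ T' ∧ ψ' (z i₀) = z := fun z hz hzZ => by
    have h := hP1 z hz fun l => hzZ (j l)
    rw [hfree z] at h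
    exact h
  have hQ2 : ∀ w ∈ T', ψ' w ∈ Ω ∧ (∀ l, eval (ψ' w) (Z.F (j l)) = 0) ∧ ψ' w i₀ = w :=
    fun w hw => by
    obtain ⟨h1, h2, h3⟩ := hP2 (cL w) hw
    refine ⟨h1, h2, ?_⟩
    have h := congrFun h3 0
    rw [hEl] at h
    exact h
  obtain ⟨hw₀T', hψ'w₀⟩ := hQ1 z₀ hz₀Ω hz₀
  -- ALL the equations vanish on the chart near `w₀ = z₀ i₀` (isolated zeros + no isolated points)
  have hkey : ∀ jj : Fin Z.m, ∀ᶠ w in 𝓝 (z₀ i₀), eval (ψ' w) (Z.F jj) = 0 := by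
    intro jj
    have hψ'at : AnalyticAt ℂ ψ' (z₀ i₀) := hψ'T' (z₀ i₀) hw₀T'
    have hg : AnalyticAt ℂ (fun w => eval (ψ' w) (Z.F jj)) (z₀ i₀) :=
      (AnalyticOnNhd.eval_mvPolynomial (Z.F jj) (ψ' (z₀ i₀)) trivial).comp hψ'at
    refine hg.frequently_zero_iff_eventually_zero.mp ?_
    intro hev
    obtain ⟨V, hV, hVo, hw₀V⟩ := eventually_nhds_iff.mp (eventually_nhdsWithin_iff.mp hev)
    -- a point of `Z` near `z₀`, other than `z₀`, with `i₀`-coordinate in `V`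
    have hNo : IsOpen (Ω ∩ (fun z : Fin Z.n → ℂ => z i₀) ⁻¹' (V ∩ T')) :=
      hΩo.inter ((hVo.inter hT'o).preimage (continuous_apply i₀))
    have hz₀N : z₀ ∈ Ω ∩ (fun z : Fin Z.n → ℂ => z i₀) ⁻¹' (V ∩ T') := ⟨hz₀Ω, hw₀V, hw₀T'⟩
    obtain ⟨z, ⟨hzΩ, hzV, _⟩, hzZ, hzne⟩ :=
      mem_closure_iff.mp (hZ.not_isolated z₀ hz₀) _ hNo hz₀N
    obtain ⟨_, hψz⟩ := hQ1 z hzΩ hzZ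
    have hne : z i₀ ≠ z₀ i₀ := fun heq => hzne (by
      show z = z₀
      rw [← hψz, heq, hψ'w₀])
    have h : ¬ eval (ψ' (z i₀)) (Z.F jj) = 0 := hV (z i₀) hzV hne
    rw [hψz] at h
    exact h (hzZ jj)
  have hall : ∀ᶠ w in 𝓝 (z₀ i₀), w ∈ T' ∧ ψ' w ∈ Z.points :=
    (hT'o.eventually_mem hw₀T').and (Filter.eventually_all.mpr hkey)
  obtain ⟨ε, hε, hball⟩ := Metric.eventually_nhds_iff_ball.mp hall
  -- the final chart
  refine ⟨ε, Ω ∩ (fun z : Fin Z.n → ℂ => z i₀) ⁻¹' Metric.ball (z₀ i₀) ε, ψ', hε,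
    hΩo.inter (Metric.isOpen_ball.preimage (continuous_apply i₀)), ⟨hz₀Ω, ?_⟩,
    fun w hw => hψ'T' w (hball w hw).1, fun z hz hzZ => ⟨hz.2, (hQ1 z hz.1 hzZ).2⟩,
    fun w hw => ?_⟩
  · show z₀ i₀ ∈ Metric.ball (z₀ i₀) ε
    exact Metric.mem_ball_self hε
  · obtain ⟨hwT', hwZ⟩ := hball w hw
    obtain ⟨hΩ, _, hi⟩ := hQ2 w hwT'
    refine ⟨⟨hΩ, ?_⟩, hwZ, hi⟩
    show ψ' w i₀ ∈ Metric.ball (z₀ i₀) ε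
    rw [hi]
    exact hw

/-- **Local holomorphic charts of an embedded smooth affine curve.** For every point `z₀` of a
smooth affine curve `Z ⊂ ℂⁿ` over `ℚ̄` there are a coordinate `i₀`, a radius `ε > 0`, an open
neighbourhood `Ω` of `z₀` in `ℂⁿ` and a map `ψ : ℂ → ℂⁿ`, holomorphic on the disc
`B = B(z₀,ᵢ₀, ε)`, such that `Z(ℂ) ∩ Ω` is exactly the graph `ψ(B)` over the `i₀`-th coordinate:
`ψ(w) ∈ Z(ℂ) ∩ Ω` and `ψ(w)ᵢ₀ = w` for `w ∈ B`, and `zᵢ₀ ∈ B`, `ψ(zᵢ₀) = z` for `z ∈ Z(ℂ) ∩ Ω`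
(Jacobian criterion `exists_jacobianMinor` + `exists_localChart_of_minor`; in the book's terms,
`Z^an` is a Riemann surface). [cite: HuberWustholz2022, §3.3.1 (p. 44), Def. 12.6 (p. 116)] -/
theorem CurveData.IsSmoothAffineCurve.exists_localChart (hZ : Z.IsSmoothAffineCurve)
    {z₀ : Fin Z.n → ℂ} (hz₀ : z₀ ∈ Z.points) :
    ∃ (i₀ : Fin Z.n) (ε : ℝ) (Ω : Set (Fin Z.n → ℂ)) (ψ : ℂ → (Fin Z.n → ℂ)), 0 < ε ∧ IsOpen Ω ∧
      z₀ ∈ Ω ∧ AnalyticOnNhd ℂ ψ (Metric.ball (z₀ i₀) ε) ∧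
      (∀ z ∈ Ω, z ∈ Z.points → z i₀ ∈ Metric.ball (z₀ i₀) ε ∧ ψ (z i₀) = z) ∧
      (∀ w ∈ Metric.ball (z₀ i₀) ε, ψ w ∈ Ω ∧ ψ w ∈ Z.points ∧ ψ w i₀ = w) := by
  obtain ⟨d, hn⟩ := Nat.exists_eq_succ_of_ne_zero (n_ne_zero_of_mem hZ hz₀)
  obtain ⟨j, a, i₀, ha, hi₀, hdet⟩ := exists_jacobianMinor hZ hz₀ hn
  exact ⟨i₀, exists_localChart_of_minor hZ hz₀ hn j a i₀ ha hi₀ hdet⟩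

/-- **The chart is a local holomorphic parametrisation by a tangent line**: with the notation
of `exists_localChart`, for `w ∈ B` the velocity `ψ′(w)` lies in `T_{ψ(w)} Z`, has
`i₀`-coordinate `1`, and every tangent vector at `ψ(w)` is `vᵢ₀ · ψ′(w)`. [folklore] -/
theorem exists_localChart_deriv (hZ : Z.IsSmoothAffineCurve) {z₀ : Fin Z.n → ℂ}
    (hz₀ : z₀ ∈ Z.points) :
    ∃ (i₀ : Fin Z.n) (ε : ℝ) (Ω : Set (Fin Z.n → ℂ)) (ψ : ℂ → (Fin Z.n → ℂ)), 0 < ε ∧ IsOpen Ω ∧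
      z₀ ∈ Ω ∧ AnalyticOnNhd ℂ ψ (Metric.ball (z₀ i₀) ε) ∧
      (∀ z ∈ Ω, z ∈ Z.points → z i₀ ∈ Metric.ball (z₀ i₀) ε ∧ ψ (z i₀) = z) ∧
      (∀ w ∈ Metric.ball (z₀ i₀) ε, ψ w ∈ Ω ∧ ψ w ∈ Z.points ∧ ψ w i₀ = w) ∧
      (∀ w ∈ Metric.ball (z₀ i₀) ε, HasDerivAt ψ (deriv ψ w) w ∧
        deriv ψ w ∈ Z.tangentSpace (ψ w) ∧ deriv ψ w i₀ = 1 ∧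
        ∀ v ∈ Z.tangentSpace (ψ w), v = v i₀ • deriv ψ w) := by
  obtain ⟨i₀, ε, Ω, ψ, hε, hΩ, hz₀, hψ, h1, h2⟩ := hZ.exists_localChart hz₀
  refine ⟨i₀, ε, Ω, ψ, hε, hΩ, hz₀, hψ, h1, h2, fun w hw => ?_⟩
  have hd : DifferentiableAt ℂ ψ w := (hψ w hw).differentiableAt
  have hnhds : ∀ᶠ v in 𝓝 w, v ∈ Metric.ball (z₀ i₀) ε := Metric.isOpen_ball.mem_nhds hw
  have hmem : deriv ψ w ∈ Z.tangentSpace (ψ w) :=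
    deriv_mem_tangentSpace_of_eventually_mem hd (hnhds.mono fun v hv => (h2 v hv).2.1)
  have hone : deriv ψ w i₀ = 1 :=
    deriv_apply_eq_one_of_eventually_eq hd (hnhds.mono fun v hv => (h2 v hv).2.2)
  exact ⟨hd.hasDerivAt, hmem, hone, fun v hv =>
    eq_smul_of_mem_tangentSpace hZ (h2 w hw).2.1 hmem hv hone⟩

end CurvePeriods

end Literature.NumberTheory.Transcendental

end
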